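import Summits.BirchSwinnertonDyer.BirchSwinnertonDyer.Theorems.KimAtThreeDeepUpperNonAdditiveRows
import Summits.BirchSwinnertonDyer.Rank1Residual.Partition.MainConjecturesRankZeroMazur
import HarnessLib

/-!
# Route `KimAtThreeKolyvagin` (rung W2), crux `DeepLowerAtThreeOffKatoStratum` (item 19679, §L child of
# `DeepLowerAtThree` 19075), NON-ADDITIVE rows: the row SOCKETS — on a `BSD(E,3)` row the LOWER
# inequality IS «Tamagawa divisibility of deep Kurihara numbers», and the lower half of `BSD₃` BY NAME on
# the covered rows (row C1: Skinner 2016 Thm. C / Skinner–Urban 3.6.9 + Greenberg 4.1 + Mazur Cor. 4.1;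
# row C16: Yan–Zhu 2026)

Cell `bsd-addord`, seat `bsd-addord-w2-acc2` (PROGRAMME PART 1b, ACCEL-LIST row (2)), item
`stmt-BirchSwinnertonDyer-19679` (BC3 skeleton `DeepLowerAtThreeOffKatoStratum_birth.lean`, sha16
`e575d03075635394`, registered stub `stub_nonAdditive`; the companion file
`KimAtThreeDeepLowerOffStratumNonAdditiveRows` specialises these sockets to the stub's own currency).
LOWER-side mirror of w2-c5's `KimAtThreeDeepUpperNonAdditiveRows` §1–§3 (crux 19562, same rows).
Theorems only; every printed input is a hypothesis BY NAME; nothing asserted; the crux stays OPEN.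

At a tower row of analytic rank `0` (`ord(δ̃) = 0`) with the `p`-adic period transfer write
`a = ∂⁽⁰⁾(δ̃)` (`kuriharaPartial … 0`), `d = ∂^{(∞)}_{deep}(δ̃) ≤ a` (`kuriharaPartialDeepInfty`),
`s = ord_p #Ш(E/ℚ)(p)`, `c = v_p(∏_ℓ c_ℓ)`; crux 19679 at the row asks `∃ d, ∂^{(∞)}_{deep} = d ∧ a ≤ s + d`,
i.e. `a ≤ s + d` (p426576's `deepLower_conclusion_iff_le_add_deepInfty`). Miller's LOWER half
(`MissingLowerBoundAt W p`: `ord_p #Ш_an ≤ ord_p #Ш`) reads `a ≤ s + c` (p426576), his UPPER half reads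
`s + c ≤ a` (w2-c4's `sha_add_tamagawa_le_kuriharaPartial_zero_of_missingUpperBoundAt`), so:

* §1 (odd `p`, BSD currency): upper half ∧ (crux at the row) ⟹ «TamDiv-deep» `c ≤ d` — every Kurihara
  number at deep cyclic levels is divisible by `p^{v_p(∏ c_ℓ)}` (Kim 2022 Conj. 1.10, `≥` half, deep
  reading; OPEN at `p = 3`, displayed, never a fact) — `tamagawa_le_deepInfty_of_lowerRow_of_missingUpperBoundAt`;
  and GIVEN both halves (`MissingPPartAt W p`) the crux at the row ⟺ TamDiv-deep
  (`deepLower_conclusion_iff_tamagawa_le_deepInfty_of_missingPPartAt`; `⟸` is p426576's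
  `deepLower_conclusion_of_missingLowerBoundAt_of_tamagawa_le_deepInfty`, OUTRIGHT when `p ∤ ∏ c_ℓ`).
* §2 (`p = 3`): the same from `BSDp W 3` (`deepLower_conclusion_three_iff_tamagawa_le_deepInfty_of_bsdp`).
* §3 the LOWER half `MissingLowerBoundAt W 3` BY NAME on the covered non-additive rows of analytic rank
  `0` with `E[3]` irreducible: row C1 = good ORDINARY or multiplicative `3` with (ram) — Skinner 2016
  Thm. C (`hSk`; ONE socket for both reduction types: `missingLowerBoundAt_three_of_rowC1_of_skinner`),
  its main-conjecture-level twin from NUMBERED theorems only (`…_of_rowC1_of_mainConjectures_of_mazur`: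
  Skinner–Urban 2014 Thm. 3.6.9 `hSU`, Skinner 2016 Thm. A `hA`, Greenberg 1999 Thm. 4.1 `hGr`,
  Stein–Wuthrich 2013 Thm. 6.1 `hJs`/`hJn`, Greenberg–Stevens `hGS`, Mazur 1978 Cor. 4.1 `hM`, modularity
  `hmod`/`hpar`, GZK), and its good-ordinary branch from FOUR numbered facts
  (`missingLowerBoundAt_three_goodOrd_of_skinnerUrban_of_mazur`: `hSU`, `hGr`, `hM`, modularity — the
  «GV00 / Skinner–Urban lower bound at good 3» of the seat brief; Greenberg–Vatsal 2000 §3's period unit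
  is DERIVED from Mazur Cor. 4.1 in the tree); row C16 = good ordinary `3` with surj(3) — Yan–Zhu 2026
  Thm. 4.15 (`hYZ` [PUB*, flag `YZ26@3-BF-ERL-Ohta`]), Wuthrich 2014 L20 (`hW20`)
  (`missingLowerBoundAt_three_of_goodOrd_of_towerSurj`); both in one case split
  (`missingLowerBoundAt_three_covered`: not additive, ORDINARY if good, (ram) if multiplicative).
NOT in print (no socket): the lower half at good SUPERSINGULAR `3` (corners X6/X7/X8 of the partition at
`p = 3`) and at multiplicative `3` WITHOUT (ram) (corner X11a at `3`); TamDiv-deep everywhere.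
[cite: Skinner2016PacificMC, Thm. C (§1), Thm. A] [cite: SkinnerUrban2014, Thm. 3.6.9 (p. 45), Thm. 3.6.11 (p. 46)]
[cite: GreenbergLNM1716, Thm. 4.1 (p. 102)] [cite: GreenbergVatsal2000, §3, Remark 3.4] [cite: Mazur1978, Cor. 4.1]
[cite: YanZhu2024MainConjNonCM, Thm. 4.15 (§4.6)] [cite: Wuthrich2014, Lemma 20 (p. 399)] [cite: Miller2011LMS, Def. 1.1]
[cite: Kim2022StructureSelmer, §1.5.1, Conj. 1.10 (PDF pp. 7–8), Thm. 1.9 (6)] [cite: MazurRubin2004, Def. 5.2.11, Thm. 5.2.12]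
-/


set_option autoImplicit false
-- the Theorems namespace of a single-conjunct summit repeats the summit name by design (D-0017)
set_option linter.dupNamespace false

noncomputable section

open scoped MatrixGroups ModularForm Classical

open CongruenceSubgroup WeierstrassCurve Literature.NumberTheory.EllipticCurves
  Literature.NumberTheory.EllipticCurves.ModularForms
  Literature.NumberTheory.EllipticCurves.Rank1Residual
  Literature.NumberTheory.EllipticCurves.Rank1Residual.Typed
  Literature.NumberTheory.EllipticCurves.Skinner2016
  Literature.NumberTheory.EllipticCurves.SteinWuthrich2013
  Summit.BirchSwinnertonDyer.BirchSwinnertonDyer.Theorems.Rank1ResidualX1Defs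

namespace Summit.BirchSwinnertonDyer.BirchSwinnertonDyer.Theorems.KimAtThreeDeepLowerOffStratumSockets

open Summit.BirchSwinnertonDyer.Rank1Residual
open Summit.BirchSwinnertonDyer.BirchSwinnertonDyer.Theses.KimAtThreeKolyvagin
open Summit.BirchSwinnertonDyer.BirchSwinnertonDyer.Theorems.KimAtThreeKolyvaginUnitLevelOneRungs
open Summit.BirchSwinnertonDyer.BirchSwinnertonDyer.Theorems.KimAtThreeDeepLowerSmallDefect
open Summit.BirchSwinnertonDyer.BirchSwinnertonDyer.Theorems.KimAtThreeDeepLowerNonAdditiveRows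
open Summit.BirchSwinnertonDyer.BirchSwinnertonDyer.Theorems.KimAtThreeShallowEqDeepOffStratumSockets
open Summit.BirchSwinnertonDyer.BirchSwinnertonDyer.Theorems.KimAtThreeShallowEqDeepOffStratumNonAdditiveRows

/-! ### §1 BSD currency (general odd `p`): on a `BSD_p` row the LOWER conclusion is TamDiv-deep -/

section BSDCurrency

variable (W : WeierstrassCurve ℚ) [W.IsElliptic] [W.IsGloballyMinimal] (p : ℕ) [Fact p.Prime]
  {N : ℕ} [NeZero N] (f : CuspForm (Gamma0 N) 2)

/-- **Necessity: the LOWER conclusion at the row ∧ the upper half of `BSD_p` ⟹ TamDiv-deep.** On the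
row of §1 (odd `p`, `E[p]` irreducible, `f` the newform of `W`, analytic rank `0`, `p`-adic period
transfer, GZK) Miller's `MissingUpperBoundAt W p` reads `s + c ≤ a` (w2-c4's
`sha_add_tamagawa_le_kuriharaPartial_zero_of_missingUpperBoundAt`); with `a ≤ s + d` this gives
`c ≤ d`: `p^{v_p(∏ c_ℓ)}` divides every Kurihara number at deep cyclic levels (Kim 2022 Conj. 1.10, `≥`
half, deep reading). [cite: Miller2011LMS, Def. 1.1] [cite: Kim2022StructureSelmer, Conj. 1.10 (PDF p. 8), §1.5.1 (PDF p. 7)] -/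
theorem tamagawa_le_deepInfty_of_lowerRow_of_missingUpperBoundAt
    (hGZK : rank_eq_analyticRank_of_analyticRank_le_one) (hp2 : p ≠ 2)
    (hirr : W.HasIrreducibleModPGaloisRep p) (hf : IsNewformOf W f)
    (hord : kuriharaVanishingOrder W p f = 0)
    (hper : ∃ u : ℚ, ‖(u : ℚ_[p])‖ = 1 ∧ W.realPeriodRat = u * plusPeriod f)
    (hup : MissingUpperBoundAt W p)
    (hL : ∃ d : ℕ, kuriharaPartialDeepInfty W p f = d ∧
      kuriharaPartial W p f 0 ≤
        ((padicValNat p (Nat.card (AddCommGroup.primaryComponent W.sha p)) + d : ℕ) : ℕ∞)) :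
    ((padicValNat p W.tamagawaProduct : ℕ) : ℕ∞) ≤ kuriharaPartialDeepInfty W p f := by
  obtain ⟨d, hd, hle⟩ := hL
  have h := (sha_add_tamagawa_le_kuriharaPartial_zero_of_missingUpperBoundAt W p f hGZK hp2 hirr hf hord
    hper hup).trans hle
  rw [hd]
  have h' : padicValNat p (Nat.card (AddCommGroup.primaryComponent W.sha p)) +
      padicValNat p W.tamagawaProduct ≤
      padicValNat p (Nat.card (AddCommGroup.primaryComponent W.sha p)) + d := by exact_mod_cast h
  exact_mod_cast Nat.le_of_add_le_add_left h'

/-- **On a `BSD_p` row the LOWER conclusion IS TamDiv-deep**: granted both halves (`MissingPPartAt W p`),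
`(∃ d, ∂^{(∞)}_{deep} = d ∧ a ≤ s + d) ↔ (c ≤ ∂^{(∞)}_{deep})` (`←` is w2-c2's
`deepLower_conclusion_of_missingLowerBoundAt_of_tamagawa_le_deepInfty`): where the `p`-part of BSD is in
print the crux says EXACTLY «every Kurihara number at deep cyclic levels has
`ord_p ≥ ord_p δ̃₁ − ord_p #Ш(p) = v_p(∏ c_ℓ)`». [cite: Miller2011LMS, Def. 1.1]
[cite: Kim2022StructureSelmer, Conj. 1.10 (PDF p. 8), Thm. 1.9 (6)] -/
theorem deepLower_conclusion_iff_tamagawa_le_deepInfty_of_missingPPartAt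
    (hGZK : rank_eq_analyticRank_of_analyticRank_le_one) (hp2 : p ≠ 2)
    (hirr : W.HasIrreducibleModPGaloisRep p) (hf : IsNewformOf W f)
    (hord : kuriharaVanishingOrder W p f = 0)
    (hper : ∃ u : ℚ, ‖(u : ℚ_[p])‖ = 1 ∧ W.realPeriodRat = u * plusPeriod f)
    (hbsd : MissingPPartAt W p) :
    (∃ d : ℕ, kuriharaPartialDeepInfty W p f = d ∧
      kuriharaPartial W p f 0 ≤
        ((padicValNat p (Nat.card (AddCommGroup.primaryComponent W.sha p)) + d : ℕ) : ℕ∞)) ↔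
      ((padicValNat p W.tamagawaProduct : ℕ) : ℕ∞) ≤ kuriharaPartialDeepInfty W p f := by
  obtain ⟨hlow, hup⟩ := lower_and_upper_of_missingPPartAt W p hbsd
  exact ⟨tamagawa_le_deepInfty_of_lowerRow_of_missingUpperBoundAt W p f hGZK hp2 hirr hf hord hper hup,
    deepLower_conclusion_of_missingLowerBoundAt_of_tamagawa_le_deepInfty W p f hGZK hp2 hirr hf hord
      hper hlow⟩

end BSDCurrency

/-! ### §2 `p = 3`: from `BSD(E,3)` (any reduction type at `3`) -/

section Row

variable (W : WeierstrassCurve ℚ) [W.IsElliptic] [W.IsGloballyMinimal]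
  {N : ℕ} [NeZero N] (f : CuspForm (Gamma0 N) 2)

/-- **On a `BSD(E,3)` tower row of analytic rank `0` with the `3`-adic period transfer, the LOWER
conclusion is EQUIVALENT to TamDiv-deep** (`v₃(∏ c_ℓ) ≤ ∂^{(∞)}_{deep}(δ̃)`); the `←` half alone is
w2-c2's `deepLower_conclusion_three_of_bsdp_of_tamagawa_le_deepInfty`. [cite: Miller2011LMS, Def. 1.1]
[cite: Kim2022StructureSelmer, Conj. 1.10 (PDF p. 8)] -/
theorem deepLower_conclusion_three_iff_tamagawa_le_deepInfty_of_bsdp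
    (hGZK : rank_eq_analyticRank_of_analyticRank_le_one)
    (htower : ∀ n : ℕ, W.HasSurjectiveModNGaloisRep (3 ^ n : ℕ)) (hfin : Finite W.sha)
    (hf : IsNewformOf W f) (hord : kuriharaVanishingOrder W 3 f = 0)
    (hper : ∃ u : ℚ, ‖(u : ℚ_[3])‖ = 1 ∧ W.realPeriodRat = u * plusPeriod f)
    (hbsd : haveI : Fact (Nat.Prime 3) := ⟨Nat.prime_three⟩; BSDp W 3) :
    (∃ d : ℕ, kuriharaPartialDeepInfty W 3 f = d ∧
      kuriharaPartial W 3 f 0 ≤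
        ((padicValNat 3 (Nat.card (AddCommGroup.primaryComponent W.sha 3)) + d : ℕ) : ℕ∞)) ↔
      ((padicValNat 3 W.tamagawaProduct : ℕ) : ℕ∞) ≤ kuriharaPartialDeepInfty W 3 f := by
  haveI : Fact (Nat.Prime 3) := ⟨Nat.prime_three⟩
  haveI : Finite W.sha := hfin
  exact deepLower_conclusion_iff_tamagawa_le_deepInfty_of_missingPPartAt W 3 f hGZK (by norm_num)
    (hasIrreducibleModPGaloisRep_of_hasSurjectiveModNGaloisRep W 3 (by simpa using htower 1))
    hf hord hper (missingPPartAt_of_bsdp W 3 hbsd)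

end Row

/-! ### §3 The LOWER half of `BSD₃` on the covered non-additive rows, by name -/

section LowerHalf

variable (W : WeierstrassCurve ℚ) [W.IsElliptic] [W.IsGloballyMinimal]

/-- **Row C1 at `3` ⟹ `MissingLowerBoundAt W 3`**: analytic rank `0`, `E[3]` irreducible, good ORDINARY
or multiplicative reduction at `3`, and Skinner's (ram) witness (a prime `ℓ ≠ 3`, `ℓ ‖ N`, `3 ∤ ord_ℓ Δ`):
`BSDp W 3` from Skinner 2016 Thm. C (`hSk`, as printed for BOTH reduction types), modularity `hmod`, GZK
`hGZK` (`RowC1.bsdp`); then Miller's bookkeeping. ONE socket for the good-ordinary-(ram) and the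
multiplicative-(ram) rows. [cite: Skinner2016PacificMC, Thm. C (§1)] [cite: Miller2011LMS, Def. 1.1] -/
theorem missingLowerBoundAt_three_of_rowC1_of_skinner
    (hSk : Skinner2016.thmC_padicValRat_bsd_rank_zero)
    (hmod : hasEntireLFunction_rat) (hGZK : rank_eq_analyticRank_of_analyticRank_le_one)
    (hr0 : W.analyticRank = 0) (hirr : W.HasIrreducibleModPGaloisRep 3)
    (hred : (W.HasGoodReductionAtPrime 3 ∧ ¬ (3 : ℤ) ∣ W.frobeniusTrace 3) ∨
      W.HasMultiplicativeReductionAtPrime 3)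
    (hram : haveI : Fact (Nat.Prime 3) := ⟨Nat.prime_three⟩; Ram W 3) :
    MissingLowerBoundAt W 3 := by
  haveI : Fact (Nat.Prime 3) := ⟨Nat.prime_three⟩
  have hred' : GoodOrd W 3 ∨ Mult W 3 := by
    rcases hred with ⟨hg, ho⟩ | hm
    · exact Or.inl ⟨hg, by exact_mod_cast ho⟩
    · exact Or.inr hm
  have hC1 : RowC1 W 3 := ⟨hr0, le_rfl, hred', hirr, hram⟩
  haveI : Finite W.sha := (hGZK W (by rw [hr0]; exact zero_le_one)).2
  exact (lower_and_upper_of_missingPPartAt W 3 (missingPPartAt_of_bsdp W 3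
    (RowC1.bsdp hSk hmod hGZK hC1))).1

/-- **Row C1 at `3` ⟹ `MissingLowerBoundAt W 3` from NUMBERED THEOREMS only** (the main-conjecture
level of the same row): Skinner–Urban 2014 Thm. 3.6.9 (`hSU`, bsd.S21; good-ordinary branch, integral
clause via (irr) + (ram) ⇒ `ρ_{E,3^∞}` onto), Skinner 2016 Thm. A (`hA`; multiplicative branch),
Greenberg 1999 Thm. 4.1 (`hGr`), Stein–Wuthrich 2013 Thm. 6.1 (`hJs`, `hJn`), Greenberg–Stevens (`hGS`),
Mazur 1978 Cor. 4.1 (`hM`, supplying Greenberg–Vatsal 2000 §3's period unit), modularity (`hmod`, `hpar`),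
GZK (`RowC1.bsdp_of_mainConjectures_of_mazur`). [cite: SkinnerUrban2014, Thm. 3.6.9 (p. 45)]
[cite: Skinner2016PacificMC, Thm. A, §3.2–3.3] [cite: GreenbergLNM1716, Thm. 4.1 (p. 102)] [cite: Mazur1978, Cor. 4.1]
[cite: SteinWuthrich2013, Thm. 6.1 (p. 20)] [cite: Miller2011LMS, Def. 1.1] -/
theorem missingLowerBoundAt_three_of_rowC1_of_mainConjectures_of_mazur
    (hSU : ∀ (W : WeierstrassCurve ℚ) [W.IsElliptic] [W.IsGloballyMinimal] (p : ℕ) [Fact p.Prime]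
      (κ : ZpExtension ℚ p) (γ : Field.absoluteGaloisGroup ℚ) (N : ℕ) [NeZero N]
      (f : CuspForm (Gamma0 N) 2),
      skinner_urban_main_conjecture W p (κ := κ) (γ := γ) (f := f))
    (hA : thmA_charIdeal_multiplicative) (hGr : greenberg_charValue_rankZero)
    (hJs : thm61_splitMultiplicative) (hJn : thm61_nonsplitMultiplicative)
    (hGS : ∀ (W : WeierstrassCurve ℚ) [W.IsElliptic] [W.IsGloballyMinimal] (p : ℕ) [Fact p.Prime],
      greenberg_stevens (W := W) (p := p))
    (hM : mazur_not_dvd_maninConstant_of_odd)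
    (hmod : hasEntireLFunction_rat) (hpar : nonempty_modularParametrizationData)
    (hGZK : rank_eq_analyticRank_of_analyticRank_le_one)
    (hr0 : W.analyticRank = 0) (hirr : W.HasIrreducibleModPGaloisRep 3)
    (hred : (W.HasGoodReductionAtPrime 3 ∧ ¬ (3 : ℤ) ∣ W.frobeniusTrace 3) ∨
      W.HasMultiplicativeReductionAtPrime 3)
    (hram : haveI : Fact (Nat.Prime 3) := ⟨Nat.prime_three⟩; Ram W 3) :
    MissingLowerBoundAt W 3 := by
  haveI : Fact (Nat.Prime 3) := ⟨Nat.prime_three⟩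
  have hred' : GoodOrd W 3 ∨ Mult W 3 := by
    rcases hred with ⟨hg, ho⟩ | hm
    · exact Or.inl ⟨hg, by exact_mod_cast ho⟩
    · exact Or.inr hm
  have hC1 : RowC1 W 3 := ⟨hr0, le_rfl, hred', hirr, hram⟩
  haveI : Finite W.sha := (hGZK W (by rw [hr0]; exact zero_le_one)).2
  exact (lower_and_upper_of_missingPPartAt W 3 (missingPPartAt_of_bsdp W 3
    (RowC1.bsdp_of_mainConjectures_of_mazur hSU hA hGr hJs hJn hGS hM hmod hpar hGZK hC1))).1

/-- **The «GV00 / Skinner–Urban lower bound at good 3» socket, from FOUR numbered facts.** On a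
good-ORDINARY row at `3` of analytic rank `0` with (irr) and (ram): Skinner–Urban 2014 Thm. 3.6.9
(`hSU`; its integral clause (3) under the surjectivity of `ρ_{E,3^∞}`, which (irr) + (ram) supply),
Greenberg 1999 Thm. 4.1 (`hGr`: `f_E(0) ∼ #Ш · ∏ c_ℓ · #Ẽ(𝔽₃)² / #E(ℚ)²_tors`), Mazur 1978 Cor. 4.1 (`hM`:
Greenberg–Vatsal 2000 §3's period unit `ord₃(Ω⁺_f/Ω_E) = 0`, derived) and modularity (`hmod`, `hpar`), with
GZK, give the rank-`0` `3`-part display (S–U Thm. 3.6.11 (a), tree `RowC1.padicValRat_rankZero_goodOrd_of_mazur`),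
hence `BSDp W 3` (`bsdp_of_pPartRankZero`) and in particular Miller's LOWER half. (Only the `⊇` divisibility
`L_p ∣ char X` of S–U is needed for the lower half; the tree's bsd.S21 packages the equality.)
[cite: SkinnerUrban2014, Thm. 3.6.9 (p. 45), Thm. 3.6.11 (a) (p. 46)] [cite: GreenbergLNM1716, Thm. 4.1 (p. 102)]
[cite: GreenbergVatsal2000, §3, Remark 3.4] [cite: Mazur1978, Cor. 4.1] [cite: Miller2011LMS, Def. 1.1] -/
theorem missingLowerBoundAt_three_goodOrd_of_skinnerUrban_of_mazur
    (hSU : ∀ (W : WeierstrassCurve ℚ) [W.IsElliptic] [W.IsGloballyMinimal] (p : ℕ) [Fact p.Prime]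
      (κ : ZpExtension ℚ p) (γ : Field.absoluteGaloisGroup ℚ) (N : ℕ) [NeZero N]
      (f : CuspForm (Gamma0 N) 2),
      skinner_urban_main_conjecture W p (κ := κ) (γ := γ) (f := f))
    (hGr : greenberg_charValue_rankZero) (hM : mazur_not_dvd_maninConstant_of_odd)
    (hmod : hasEntireLFunction_rat) (hpar : nonempty_modularParametrizationData)
    (hGZK : rank_eq_analyticRank_of_analyticRank_le_one)
    (hr0 : W.analyticRank = 0) (hirr : W.HasIrreducibleModPGaloisRep 3)
    (hgood : W.HasGoodReductionAtPrime 3) (hord3 : ¬ (3 : ℤ) ∣ W.frobeniusTrace 3)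
    (hram : haveI : Fact (Nat.Prime 3) := ⟨Nat.prime_three⟩; Ram W 3) :
    MissingLowerBoundAt W 3 := by
  haveI : Fact (Nat.Prime 3) := ⟨Nat.prime_three⟩
  have hord : GoodOrd W 3 := ⟨hgood, by exact_mod_cast hord3⟩
  obtain ⟨q, hq, hv⟩ :=
    RowC1.padicValRat_rankZero_goodOrd_of_mazur hSU hGr hM hmod hpar hGZK hr0 le_rfl hord hirr hram
  haveI : Finite W.sha := (hGZK W (by rw [hr0]; exact zero_le_one)).2
  exact (lower_and_upper_of_missingPPartAt W 3 (missingPPartAt_of_bsdp W 3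
    (bsdp_of_pPartRankZero W 3 hmod hGZK hr0 ⟨q, hq, hv⟩))).1

/-- **Row C16 ⟹ `MissingLowerBoundAt W 3`**: good ordinary `3`, tower onto (so `E[3]` irreducible and
surj(3)), analytic rank `0`: `BSDp W 3` from Yan–Zhu 2026 Thm. 4.15 (`hYZ`, PUB*, flag
`YZ26@3-BF-ERL-Ohta`), Wuthrich 2014 Lemma 20 (`hW20`), modularity, GZK (`RowC16.bsdp`); then Miller's
bookkeeping. No (ram) needed. [cite: YanZhu2024MainConjNonCM, Thm. 4.15 (§4.6)] [cite: Wuthrich2014, Lemma 20 (p. 399)]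
[cite: Miller2011LMS, Def. 1.1] -/
theorem missingLowerBoundAt_three_of_goodOrd_of_towerSurj
    (hYZ : YanZhu2026.thm415_padicValRat_bsd_rank_le_one)
    (hW20 : Wuthrich2014.lemma20_surjective_threeAdic_of_semistable)
    (hmod : hasEntireLFunction_rat) (hGZK : rank_eq_analyticRank_of_analyticRank_le_one)
    (htower : ∀ n : ℕ, W.HasSurjectiveModNGaloisRep (3 ^ n : ℕ)) (hr0 : W.analyticRank = 0)
    (hgood : W.HasGoodReductionAtPrime 3) (hord3 : ¬ (3 : ℤ) ∣ W.frobeniusTrace 3) :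
    MissingLowerBoundAt W 3 := by
  haveI : Fact (Nat.Prime 3) := ⟨Nat.prime_three⟩
  have hsurj : Surj W 3 := by
    have h := htower 1
    rw [pow_one] at h
    exact h
  have hirr : Irr W 3 := hasIrreducibleModPGaloisRep_of_hasSurjectiveModNGaloisRep W 3 hsurj
  have hC16 : RowC16 W 3 := ⟨rfl, ⟨hgood, by exact_mod_cast hord3⟩, hirr, Or.inl hsurj⟩
  haveI : Finite W.sha := (hGZK W (by rw [hr0]; exact zero_le_one)).2
  exact (lower_and_upper_of_missingPPartAt W 3 (missingPPartAt_of_bsdp W 3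
    (RowC16.bsdp hYZ hW20 hmod hGZK (by rw [hr0]; exact zero_le_one) hC16))).1

/-- **The covered non-additive tower rows, in one socket**: tower onto, analytic rank `0`, not additive at
`3`, ORDINARY if good, (ram) if multiplicative ⟹ `MissingLowerBoundAt W 3` from `hYZ`, `hW20`, `hSk`,
`hmod`, `hGZK` (good ordinary: row C16; multiplicative (ram): row C1). [cite: YanZhu2024MainConjNonCM, Thm. 4.15 (§4.6)]
[cite: Skinner2016PacificMC, Thm. C (§1)] [cite: Miller2011LMS, Def. 1.1] -/
theorem missingLowerBoundAt_three_covered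
    (hYZ : YanZhu2026.thm415_padicValRat_bsd_rank_le_one)
    (hW20 : Wuthrich2014.lemma20_surjective_threeAdic_of_semistable)
    (hSk : Skinner2016.thmC_padicValRat_bsd_rank_zero)
    (hmod : hasEntireLFunction_rat) (hGZK : rank_eq_analyticRank_of_analyticRank_le_one)
    (htower : ∀ n : ℕ, W.HasSurjectiveModNGaloisRep (3 ^ n : ℕ)) (hr0 : W.analyticRank = 0)
    (hnA : ¬ (haveI : Fact (Nat.Prime 3) := ⟨Nat.prime_three⟩; Addv W 3))
    (hordinary : W.HasGoodReductionAtPrime 3 → ¬ (3 : ℤ) ∣ W.frobeniusTrace 3)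
    (hram : W.HasMultiplicativeReductionAtPrime 3 →
      (haveI : Fact (Nat.Prime 3) := ⟨Nat.prime_three⟩; Ram W 3)) :
    MissingLowerBoundAt W 3 := by
  haveI : Fact (Nat.Prime 3) := ⟨Nat.prime_three⟩
  by_cases hgood : W.HasGoodReductionAtPrime 3
  · exact missingLowerBoundAt_three_of_goodOrd_of_towerSurj W hYZ hW20 hmod hGZK htower hr0 hgood
      (hordinary hgood)
  · have hmult : W.HasMultiplicativeReductionAtPrime 3 := by
      by_contra h
      exact hnA ⟨hgood, h⟩
    exact missingLowerBoundAt_three_of_rowC1_of_skinner W hSk hmod hGZK hr0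
      (hasIrreducibleModPGaloisRep_of_hasSurjectiveModNGaloisRep W 3 (by simpa using htower 1))
      (Or.inr hmult) (hram hmult)

end LowerHalf

end Summit.BirchSwinnertonDyer.BirchSwinnertonDyer.Theorems.KimAtThreeDeepLowerOffStratumSockets

end
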